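import Mathlib
import Summits.NavierStokesRegularity.NavierStokesRegularity.Theses.AxisymmetricExtremality

/-!
# Strategist s19-g17 (family s, independent second census) — typed attempts for the crux
`AxisymmetricKatoGlobal` (stmt-NavierStokesRegularity-15453) of route AxisymmetricExtremality.

Kernel-checked bookkeeping only (no `sorry`): the weaker intermediate `closes` actually consumes
(W0 = no axisymmetric Ḣ^{1/2}-minimal blow-up datum), its derivation from the crux, the fact that it
still decides the summit together with the two other cruxes, and two typed sufficient forms
(threshold gap / infinite threshold). The census `STRATEGY-CENSUS-s19-g17.md` explains why none of
these has leverage short of the crux itself.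
-/

namespace Summit.NavierStokesRegularity.NavierStokesRegularity.Cruxes.AxisymmetricKatoGlobal.StrategistS19g17

open Literature.Analysis Literature.Analysis.FluidPDE MeasureTheory
open Summit.NavierStokesRegularity.NavierStokesRegularity.Theses.AxisymmetricExtremality
open scoped ENNReal

/-- Equivariance under every rotation about the `x₂`-axis, written out exactly as in the route
file (`IsAxisymmetric u₀` unfolded). -/
def RotZEquivariant (u₀ : EuclideanSpace ℝ (Fin 3) → EuclideanSpace ℝ (Fin 3)) : Prop :=
  ∀ (θ : ℝ) (x : EuclideanSpace ℝ (Fin 3)),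
    u₀ (WithLp.toLp 2 ![Real.cos θ * x 0 - Real.sin θ * x 1, Real.sin θ * x 0 + Real.cos θ * x 1, x 2]) =
      WithLp.toLp 2 ![Real.cos θ * u₀ x 0 - Real.sin θ * u₀ x 1, Real.sin θ * u₀ x 0 + Real.cos θ * u₀ x 1, u₀ x 2]

/-- **W0 — the weaker intermediate `closes` actually consumes**: no axisymmetric datum lies in
Rusin–Šverák's set `M` of `Ḣ^{1/2}`-minimal blow-up data (threshold instance of the crux). -/
def NoAxisymmetricMinimalDatum : Prop :=
  ∀ ν : ℝ, 0 < ν → ∀ (u₀ : EuclideanSpace ℝ (Fin 3) → EuclideanSpace ℝ (Fin 3))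
    (g : FunctionSpaces.HomSobolev (EuclideanSpace ℝ (Fin 3)) (EuclideanSpace ℂ (Fin 3)) (1 / 2 : ℝ)),
    IsMinimalBlowupDatum ν u₀ g → RotZEquivariant u₀ → False

/-- The crux implies W0 (one line: minimal data have no global Kato solution). -/
theorem noAxisymmetricMinimalDatum_of_crux (h : AxisymmetricKatoGlobal) : NoAxisymmetricMinimalDatum := by
  intro ν hν u₀ g hmin hax
  obtain ⟨hL3, hrep, hdiv, -, hnot⟩ := hmin
  exact hnot (h ν hν u₀ g hL3 hrep hdiv hax)

/-- W0 decides the summit together with the route's other two cruxes — the same pure-logic proof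
as the route's `closes`, with W0 in place of the crux. -/
theorem closes_of_noAxisymmetricMinimalDatum (h₂ : MinimalDatumPFold) (h₄ : PFoldToAxisymmetric)
    (hW : NoAxisymmetricMinimalDatum) : NavierStokesRegularity := by
  show Literature.NS.NavierStokesExistenceSmoothR3
  intro ν hν u₀ hsm hdiv hdec
  by_contra hno
  obtain ⟨u₁, g, hmin, hax⟩ := h₄ ν hν (h₂ ν hν ⟨u₀, hsm, hdiv, hdec, hno⟩)
  exact hW ν hν u₁ g hmin hax

/-- The threshold of the axisymmetric class: `ρ_ax(ν) = sup {ρ | every axisymmetric weakly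
divergence-free L³ datum represented in Ḣ^{1/2} with norm < ρ has a global Kato solution}`. -/
noncomputable def axisymThreshold (ν : ℝ) : ℝ≥0∞ :=
  sSup {ρ : ℝ≥0∞ | ∀ (u₀ : EuclideanSpace ℝ (Fin 3) → EuclideanSpace ℝ (Fin 3))
    (g : FunctionSpaces.HomSobolev (EuclideanSpace ℝ (Fin 3)) (EuclideanSpace ℂ (Fin 3)) (1 / 2 : ℝ)),
    MemLp u₀ 3 → g.Represents (FunctionSpaces.EuclideanSpace.complexify ∘ u₀) → IsWeaklyDivFree u₀ →
    RotZEquivariant u₀ → ‖g‖ₑ < ρ → HasGlobalKatoSolution ν u₀}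

/-- Below the axisymmetric threshold, axisymmetric data are global (unfolding the `sSup`). -/
theorem hasGlobalKatoSolution_of_lt_axisymThreshold {ν : ℝ}
    {u₀ : EuclideanSpace ℝ (Fin 3) → EuclideanSpace ℝ (Fin 3)}
    {g : FunctionSpaces.HomSobolev (EuclideanSpace ℝ (Fin 3)) (EuclideanSpace ℂ (Fin 3)) (1 / 2 : ℝ)}
    (hu₀ : MemLp u₀ 3) (hg : g.Represents (FunctionSpaces.EuclideanSpace.complexify ∘ u₀))
    (hdiv : IsWeaklyDivFree u₀) (hax : RotZEquivariant u₀) (hlt : ‖g‖ₑ < axisymThreshold ν) :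
    HasGlobalKatoSolution ν u₀ := by
  obtain ⟨ρ, hρ, hltρ⟩ := lt_sSup_iff.1 hlt
  exact hρ u₀ g hu₀ hg hdiv hax hltρ

/-- `ρ_max^pure(ν) ≤ ρ_ax(ν)` (the axisymmetric class is a subclass). -/
theorem rusinSverakRhoMaxPure_le_axisymThreshold (ν : ℝ) : rusinSverakRhoMaxPure ν ≤ axisymThreshold ν := by
  unfold rusinSverakRhoMaxPure axisymThreshold
  apply sSup_le_sSup
  intro ρ hρ u₀ g hu₀ hg hdiv _hax hlt
  exact hρ u₀ g hu₀ hg hdiv hlt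

/-- **Class-threshold reformulation (kernel-checked):** the crux is literally `ρ_ax(ν) = ∞` for
every `ν > 0`. -/
theorem crux_iff_axisymThreshold_eq_top :
    AxisymmetricKatoGlobal ↔ ∀ ν : ℝ, 0 < ν → axisymThreshold ν = ⊤ := by
  constructor
  · intro h ν hν
    apply top_le_iff.1
    apply le_sSup
    intro u₀ g hu₀ hg hdiv hax _hlt
    exact h ν hν u₀ g hu₀ hg hdiv hax
  · intro h ν hν u₀ g hu₀ hg hdiv hax
    apply hasGlobalKatoSolution_of_lt_axisymThreshold hu₀ hg hdiv hax
    rw [h ν hν]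
    exact enorm_lt_top

/-- **Typed sufficient form 1 (non-extremality gap):** if, whenever the pure threshold is finite,
the axisymmetric threshold is strictly larger, then W0 holds (a minimal datum has norm exactly
`ρ_max^pure < ρ_ax`, hence is global — contradiction). -/
theorem noAxisymmetricMinimalDatum_of_gap
    (h : ∀ ν : ℝ, 0 < ν → rusinSverakRhoMaxPure ν < ⊤ → rusinSverakRhoMaxPure ν < axisymThreshold ν) :
    NoAxisymmetricMinimalDatum := by
  intro ν hν u₀ g hmin hax
  obtain ⟨hL3, hrep, hdiv, hnorm, hnot⟩ := hmin
  have hfin : rusinSverakRhoMaxPure ν < ⊤ := by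
    rw [← hnorm]; exact enorm_lt_top
  have hlt : ‖g‖ₑ < axisymThreshold ν := by
    rw [hnorm]; exact h ν hν hfin
  exact hnot (hasGlobalKatoSolution_of_lt_axisymThreshold hL3 hrep hdiv hax hlt)

/-- **Typed sufficient form 2 (infinite pure threshold, i.e. critical-space regularity):** then no
minimal blow-up datum exists at all, axisymmetric or not. -/
theorem noAxisymmetricMinimalDatum_of_rhoMax_top (h : ∀ ν : ℝ, 0 < ν → rusinSverakRhoMaxPure ν = ⊤) :
    NoAxisymmetricMinimalDatum := by
  intro ν hν u₀ g hmin _hax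
  obtain ⟨-, -, -, hnorm, -⟩ := hmin
  exact (enorm_ne_top (x := g)) (hnorm.trans (h ν hν))

/-- **Decomposition attempt (bounded / unbounded swirl), typed:** the crux restricted to data with
bounded swirl `Γ = x₀ u₁ − x₁ u₀` — the classical axisymmetric-with-swirl problem in the critical
class. The crux trivially implies it; the census records why the complementary piece is the crux
again (Ḣ^{1/2} data with unbounded Γ exist and Γ ∉ L^∞ persists under the flow). -/
def AxisymmetricKatoGlobalBoundedSwirl : Prop :=
  ∀ ν : ℝ, 0 < ν → ∀ (u₀ : EuclideanSpace ℝ (Fin 3) → EuclideanSpace ℝ (Fin 3))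
    (g : FunctionSpaces.HomSobolev (EuclideanSpace ℝ (Fin 3)) (EuclideanSpace ℂ (Fin 3)) (1 / 2 : ℝ)),
    MemLp u₀ 3 → g.Represents (FunctionSpaces.EuclideanSpace.complexify ∘ u₀) → IsWeaklyDivFree u₀ →
    RotZEquivariant u₀ → (∃ C : ℝ, ∀ x : EuclideanSpace ℝ (Fin 3), |x 0 * u₀ x 1 - x 1 * u₀ x 0| ≤ C) →
    HasGlobalKatoSolution ν u₀

theorem boundedSwirl_of_crux (h : AxisymmetricKatoGlobal) : AxisymmetricKatoGlobalBoundedSwirl := by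
  intro ν hν u₀ g hu₀ hg hdiv hax _hΓ
  exact h ν hν u₀ g hu₀ hg hdiv hax

end Summit.NavierStokesRegularity.NavierStokesRegularity.Cruxes.AxisymmetricKatoGlobal.StrategistS19g17
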